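import Literature.AlgebraicGeometry.Resolution.GeneralizedStability
import Literature.AlgebraicGeometry.Resolution.TranscendentallyImmediate
import Literature.AlgebraicGeometry.Resolution.ValuationDefectExample
import Literature.AlgebraicGeometry.Resolution.GeneralizedStabilityFiniteRankLemmas
import Mathlib.FieldTheory.Relrank
import Mathlib.FieldTheory.PurelyInseparable.PerfectClosure
import HarnessLib

/-!
# Ramification index and inertia degree computed inside an ambient valued field

Topic: `Literature/AlgebraicGeometry/Resolution` (valued function fields). Auxiliary, PROVED
material for the reduction of Temkin 2013, Thm. 5.5.3 (`Temkin2013_Thm553`,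
`AbhyankarToroidalCharts.lean`) to the generalized stability theorem (`Kuhlmann2010Stability`,
`ValuationDefect.lean`), carried out in `AbhyankarConstantReduction.lean` and
`AbhyankarResidueSeparability.lean`. That reduction compares the invariants `e`, `f` of ONE
finite extension `M/L` of valued fields at many "levels" `L ⊆ M` inside a fixed big valued field
`(Ω, V)` (an algebraic closure of the function field with a chosen extension `V` of its valuation
ring). The dictionary between the abstract invariants of `ValuationDefect.lean`
(`ramificationIndex`, `inertiaDegree` of `V ∩ M` over `L`) and the relative index / relative degree
of the value subgroups / residue subfields inside the single ambient `V` is `DefectAmbient.lean`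
(`ramificationIndex_comap_eq_relIndex`, `inertiaDegree_comap_eq_relfinrank`); this file adds the
subfield-indexed bookkeeping and the transfer lemmas used level by level:

* `valGroup V X` — the subgroup `|X^×| ≤ |Ω^×|` of values of a subfield `X ⊆ Ω`
  (`valueSubgroup_eq_valGroup`: for a type `K → Ω` it is `valueSubgroup K V`); the residue field
  `resField V X ≤ Ṽ` of `X` is `ValuedFunctionFields.resField` (`residueSubfield_eq_resField`,
  `GeneralizedStabilityFiniteRankLemmas.lean`).
* `mem_iff_mem_of_pow_mem`, `mem_iff_mem_of_mem_perfectClosure` — a valuation ring is determined on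
  the relative perfect closure of a subfield by its trace on the subfield (uniqueness of
  extensions in purely inseparable extensions, ambient form; `mem_valuationSubring_iff_pow_mem`
  of `ValuationDefectExample.lean`).
* `linearIndependent_valuation_of_forall_mem_iff`, `algebraicIndependent_residue_iff`,
  `algebraicIndependent_residue_of_forall_mem_iff` — independence of values / residues of a
  system only depends on the trace of the valuation ring on a subfield containing it (values via
  `linearIndependent_valuation_iff` of `TranscendentallyImmediate.lean`).
* `relfinrank_le_relfinrank_of_span` — the linear algebra behind "residue degrees can only be
  larger at a finite level": if `A ≤ A'`, `A ≤ X ≤ X'`, `A' ≤ X'`, `[X : A] < ∞` and `X'` is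
  spanned over `A'` by a subset of `X`, then `[X' : A'] ≤ [X : A]`.

Everything here is standard valuation theory / linear algebra ([folklore]); no source is
followed.
-/

noncomputable section

namespace Literature.AlgebraicGeometry.Resolution

open IsLocalRing ValuationSubring

universe u

variable {Ω : Type u} [Field Ω]

/-! ### Values of a subfield -/

/-- The subgroup `|X^×|` of the value group `|Ω^×| = (ValueGroup V)ˣ` formed by the values of the
non-zero elements of a subfield `X ⊆ Ω`. [folklore] -/
def valGroup (V : ValuationSubring Ω) (X : Subfield Ω) : Subgroup (ValueGroup V)ˣ where
  carrier := {γ | ∃ a ∈ X, (γ : ValueGroup V) = V.valuation a}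
  one_mem' := ⟨1, X.one_mem, by simp⟩
  mul_mem' := by
    rintro γ δ ⟨a, ha, hγ⟩ ⟨b, hb, hδ⟩
    exact ⟨a * b, X.mul_mem ha hb, by rw [Units.val_mul, hγ, hδ, map_mul]⟩
  inv_mem' := by
    rintro γ ⟨a, ha, hγ⟩
    exact ⟨a⁻¹, X.inv_mem ha, by rw [Units.val_inv_eq_inv_val, hγ, map_inv₀]⟩

/-- Membership in `|X^×|`. [folklore] -/
theorem mem_valGroup_iff (V : ValuationSubring Ω) (X : Subfield Ω) (γ : (ValueGroup V)ˣ) :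
    γ ∈ valGroup V X ↔ ∃ a ∈ X, (γ : ValueGroup V) = V.valuation a := Iff.rfl

/-- `|X^×|` is monotone in `X`. [folklore] -/
theorem valGroup_mono (V : ValuationSubring Ω) {X Y : Subfield Ω} (h : X ≤ Y) :
    valGroup V X ≤ valGroup V Y := by
  rintro γ ⟨a, ha, hγ⟩
  exact ⟨a, h ha, hγ⟩

/-- The value of a non-zero element of `X` lies in `|X^×|`. [folklore] -/
theorem mk0_mem_valGroup (V : ValuationSubring Ω) {X : Subfield Ω} {a : Ω} (ha : a ∈ X)
    (ha0 : a ≠ 0) :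
    Units.mk0 (V.valuation a) ((Valuation.ne_zero_iff _).mpr ha0) ∈ valGroup V X :=
  ⟨a, ha, rfl⟩

/-- For a field `K → Ω`, the subgroup `valueSubgroup K V` of `ValuationDefect.lean` is `|K^×|` for
the image subfield. [folklore] -/
theorem valueSubgroup_eq_valGroup (K : Type u) [Field K] [Algebra K Ω] (V : ValuationSubring Ω) :
    valueSubgroup K V = valGroup V (algebraMap K Ω).fieldRange := by
  ext γ
  rw [mem_valueSubgroup_iff, mem_valGroup_iff]
  constructor
  · rintro ⟨c, -, hγ⟩
    exact ⟨algebraMap K Ω c, ⟨c, rfl⟩, hγ⟩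
  · rintro ⟨_, ⟨c, rfl⟩, hγ⟩
    refine ⟨c, fun hc => ?_, hγ⟩
    rw [hc, map_zero, map_zero] at hγ
    exact γ.ne_zero hγ


/-- Conversely `|X^×| = valueSubgroup X V` for a subfield `X ⊆ Ω` viewed as a type (the form in
which `DefectAmbient.lean` states `e` as a relative index). [folklore] -/
theorem valGroup_eq_valueSubgroup (V : ValuationSubring Ω) (X : Subfield Ω) :
    valGroup V X = valueSubgroup X V := by
  rw [valueSubgroup_eq_valGroup]
  congr 1
  ext a
  constructor
  · intro ha; exact ⟨⟨a, ha⟩, rfl⟩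
  · rintro ⟨b, rfl⟩; exact b.2

/-! ### Valuation rings agreeing on a subfield agree on its relative perfect closure -/

/-- Two valuation rings with the same trace on a subfield `X` give the same elements of `X`
value `1`. [folklore] -/
theorem valuation_eq_one_iff_of_forall_mem_iff {V V' : ValuationSubring Ω} {X : Subfield Ω}
    (h : ∀ a ∈ X, a ∈ V ↔ a ∈ V') {a : Ω} (ha : a ∈ X) :
    V.valuation a = 1 ↔ V'.valuation a = 1 := by
  by_cases ha0 : a = 0
  · simp [ha0]
  · rw [valuation_eq_one_iff_mem_and_inv_mem V ha0, valuation_eq_one_iff_mem_and_inv_mem V' ha0,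
      h a ha, h a⁻¹ (X.inv_mem ha)]

/-- Two valuation rings with the same trace on a subfield `X` have the same trace on every
element with a `p`-power in `X` (`p` the exponential characteristic). [folklore] -/
theorem mem_iff_mem_of_pow_mem {V V' : ValuationSubring Ω} {X : Subfield Ω}
    (h : ∀ a ∈ X, a ∈ V ↔ a ∈ V') (q : ℕ) [ExpChar Ω q] {a : Ω} {n : ℕ} (ha : a ^ q ^ n ∈ X) :
    a ∈ V ↔ a ∈ V' := by
  rw [mem_valuationSubring_iff_pow_mem V a (expChar_pow_pos Ω q n).ne',
    mem_valuationSubring_iff_pow_mem V' a (expChar_pow_pos Ω q n).ne']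
  exact h _ ha

/-- **Uniqueness of the extension of a valuation ring to a purely inseparable extension, ambient
form**: two valuation rings of `Ω` with the same trace on (the image of) a field `F → Ω` have the
same trace on the relative perfect closure of `F` in `Ω` (the elements with some `pⁿ`-th power in
`F`). [folklore] -/
theorem mem_iff_mem_of_mem_perfectClosure {V V' : ValuationSubring Ω} {F : Type*} [Field F]
    [Algebra F Ω] (h : ∀ a ∈ (algebraMap F Ω).range, a ∈ V ↔ a ∈ V') {a : Ω}
    (ha : a ∈ perfectClosure F Ω) : a ∈ V ↔ a ∈ V' := by
  obtain ⟨q, hq⟩ := ExpChar.exists F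
  haveI : ExpChar Ω q := expChar_of_injective_algebraMap (algebraMap F Ω).injective q
  obtain ⟨n, hn⟩ := (mem_perfectClosure_iff_pow_mem q).mp ha
  rw [mem_valuationSubring_iff_pow_mem V a (expChar_pow_pos Ω q n).ne',
    mem_valuationSubring_iff_pow_mem V' a (expChar_pow_pos Ω q n).ne']
  exact h _ hn

/-- The perfect closure of `k` in `Ω` lies in the relative perfect closure of any intermediate
`k → F → Ω`. [folklore] -/
theorem mem_perfectClosure_of_mem_perfectClosure_of_tower {k : Type*} [Field k] [Algebra k Ω]
    (F : Type*) [Field F] [Algebra k F] [Algebra F Ω] [IsScalarTower k F Ω] {a : Ω}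
    (ha : a ∈ perfectClosure k Ω) : a ∈ perfectClosure F Ω := by
  obtain ⟨q, hq⟩ := ExpChar.exists k
  haveI : ExpChar F q := expChar_of_injective_algebraMap (algebraMap k F).injective q
  obtain ⟨n, c, hc⟩ := (mem_perfectClosure_iff_pow_mem q).mp ha
  refine (mem_perfectClosure_iff_pow_mem q).mpr ⟨n, algebraMap k F c, ?_⟩
  rw [← IsScalarTower.algebraMap_apply]
  exact hc

/-! ### Independence of values and of residues only depends on the trace of the valuation ring -/

section Independence

variable (V : ValuationSubring Ω)

/-- Two valuation rings with the same trace on a subfield containing the `xⱼ` have the same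
`ℤ`-independence of the values `|xⱼ|` (through `linearIndependent_valuation_iff` of
`TranscendentallyImmediate.lean`: independence means that no non-trivial Laurent monomial in `x`
is a unit). [folklore] -/
theorem linearIndependent_valuation_of_forall_mem_iff {V V' : ValuationSubring Ω} {X : Subfield Ω}
    (h : ∀ a ∈ X, a ∈ V ↔ a ∈ V') {κ : Type*} (x : κ → Ω) (hx0 : ∀ j, x j ≠ 0)
    (hxX : ∀ j, x j ∈ X)
    (hx : LinearIndependent ℤ (fun j => Additive.ofMul (Units.mk0 (V.valuation (x j))
        (valuation_ne_zero_of_ne_zero V (hx0 j))))) :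
    LinearIndependent ℤ (fun j => Additive.ofMul (Units.mk0 (V'.valuation (x j))
        (valuation_ne_zero_of_ne_zero V' (hx0 j)))) := by
  rw [linearIndependent_valuation_iff V x hx0] at hx
  rw [linearIndependent_valuation_iff V' x hx0]
  intro s g hg
  refine hx s g ?_
  have hmem : (∏ j ∈ s, x j ^ g j) ∈ X := prod_mem fun j _ => X.zpow_mem (hxX j) _
  exact (valuation_eq_one_iff_of_forall_mem_iff h hmem).mpr hg

/-- **Algebraic independence of residues is intrinsic**: for `y` in `V` and a trivially valued
ground field `k ⊆ V`, the residues `ỹᵢ` are algebraically independent over `k` iff every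
non-zero polynomial in the `yᵢ` over `k` has value `1`. [folklore] -/
theorem algebraicIndependent_residue_iff {ι : Type*} {k : Type u} [Field k] [Algebra k Ω]
    (hk : ∀ c : k, algebraMap k Ω c ∈ V) (y : ι → Ω) (hy : ∀ i, y i ∈ V) :
    letI := algebraOfMem k V hk
    AlgebraicIndependent k (fun i => residue V ⟨y i, hy i⟩) ↔
      ∀ p : MvPolynomial ι k, p ≠ 0 → V.valuation (MvPolynomial.aeval y p) = 1 := by
  letI := algebraOfMem k V hk
  haveI := isScalarTower_algebraOfMem k V hk
  have hy' : (fun i => ((⟨y i, hy i⟩ : V) : Ω)) = y := rfl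
  constructor
  · intro h p hp
    have := valuation_aeval_eq_one V (fun i => ⟨y i, hy i⟩) h hp
    exact this
  · intro h
    rw [algebraicIndependent_iff]
    intro p hp
    by_contra hne
    have h1 := h p hne
    have h2 : MvPolynomial.aeval y p = ((MvPolynomial.aeval (fun i => (⟨y i, hy i⟩ : V)) p : V) : Ω) :=
      MvPolynomial.aeval_algebraMap_apply Ω (fun i => (⟨y i, hy i⟩ : V)) p
    have h3 : residue V (MvPolynomial.aeval (fun i => (⟨y i, hy i⟩ : V)) p) = 0 := by
      have := MvPolynomial.comp_aeval_apply (fun i => (⟨y i, hy i⟩ : V))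
        (IsScalarTower.toAlgHom k V (ResidueField V)) p
      simp only [IsScalarTower.coe_toAlgHom', ResidueField.algebraMap_eq] at this
      rw [this]
      exact hp
    rw [residue_eq_zero_iff] at h3
    have h4 : V.valuation ((MvPolynomial.aeval (fun i => (⟨y i, hy i⟩ : V)) p : V) : Ω) < 1 :=
      (V.valuation_lt_one_iff _).mp h3
    rw [← h2, h1] at h4
    exact lt_irrefl _ h4

/-- Two valuation rings containing `k` with the same trace on a subfield containing `k` and the
`yᵢ` have the same algebraic independence of the residues `ỹᵢ` over `k`. [folklore] -/
theorem algebraicIndependent_residue_of_forall_mem_iff {V V' : ValuationSubring Ω} {X : Subfield Ω}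
    (h : ∀ a ∈ X, a ∈ V ↔ a ∈ V') {ι : Type*} {k : Type u} [Field k] [Algebra k Ω]
    (hk : ∀ c : k, algebraMap k Ω c ∈ V) (hk' : ∀ c : k, algebraMap k Ω c ∈ V')
    (hkX : ∀ c : k, algebraMap k Ω c ∈ X) (y : ι → Ω) (hy : ∀ i, y i ∈ V) (hy' : ∀ i, y i ∈ V')
    (hyX : ∀ i, y i ∈ X)
    (hind : letI := algebraOfMem k V hk; AlgebraicIndependent k (fun i => residue V ⟨y i, hy i⟩)) :
    letI := algebraOfMem k V' hk'
    AlgebraicIndependent k (fun i => residue V' ⟨y i, hy' i⟩) := by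
  rw [algebraicIndependent_residue_iff V' hk' y hy']
  rw [algebraicIndependent_residue_iff V hk y hy] at hind
  intro p hp
  have hmem : MvPolynomial.aeval y p ∈ X := by
    have hX : (MvPolynomial.aeval y : MvPolynomial ι k →ₐ[k] Ω).range ≤
        (Algebra.adjoin k (X : Set Ω)) := by
      rw [← Algebra.adjoin_range_eq_range_aeval]
      exact Algebra.adjoin_mono (Set.range_subset_iff.mpr hyX)
    have hXalg : Algebra.adjoin k (X : Set Ω) ≤
        { X.toSubring.toSubsemiring with algebraMap_mem' := hkX } :=
      Algebra.adjoin_le fun a ha => ha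
    exact hXalg (hX ⟨p, rfl⟩)
  exact (valuation_eq_one_iff_of_forall_mem_iff h hmem).mp (hind p hp)

end Independence

/-! ### Relative degrees of subfields: a spanning estimate -/

/-- Coordinates in a basis of `X` over a subfield `A ≤ X`, read in the ambient field: every element
of `X` is an `A`-linear combination of the basis vectors. [folklore] -/
theorem mem_span_range_of_basis {R : Type*} [Field R] {A X : Subfield R} (hAX : A ≤ X) {ι : Type*}
    (b : Module.Basis ι A (Subfield.extendScalars hAX)) {z : R} (hz : z ∈ X) :
    z ∈ Submodule.span A (Set.range fun i => (b i : R)) := by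
  classical
  set m : Subfield.extendScalars hAX := ⟨z, hz⟩ with hm
  have hz' : (m : R) = (Finsupp.linearCombination A (fun i => (b i : R))) (b.repr m) := by
    conv_lhs => rw [← b.linearCombination_repr m]
    simp only [Finsupp.linearCombination_apply, Finsupp.sum]
    rw [AddSubmonoidClass.coe_finsetSum]
    exact Finset.sum_congr rfl fun i _ => rfl
  have hmem : (Finsupp.linearCombination A (fun i => (b i : R))) (b.repr m) ∈
      Submodule.span A (Set.range fun i => (b i : R)) := by
    rw [← Finsupp.range_linearCombination]
    exact LinearMap.mem_range_self _ _
  rw [← hz'] at hmem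
  exact hmem

/-- **Degrees can only drop when the base grows along a spanning set**: let `A ≤ A'` and
`A ≤ X ≤ X'`, `A' ≤ X'` be subfields of a field `R` with `[X : A]` finite, and suppose `X'` is
spanned over `A'` by a subset `G ⊆ X`. Then `[X' : A'] ≤ [X : A]` (an `A`-basis of `X` spans
`X'` over `A'`). [folklore] -/
theorem relfinrank_le_relfinrank_of_span {R : Type*} [Field R] {A A' X X' : Subfield R}
    (hAA' : A ≤ A') (hAX : A ≤ X) (hXX' : X ≤ X') (hA'X' : A' ≤ X')
    (hfin : 0 < A.relfinrank X) {G : Set R} (hGX : G ⊆ X)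
    (hspan : ∀ z ∈ X', z ∈ Submodule.span A' G) :
    A'.relfinrank X' ≤ A.relfinrank X := by
  classical
  rw [Subfield.relfinrank_eq_finrank_of_le hAX] at hfin ⊢
  rw [Subfield.relfinrank_eq_finrank_of_le hA'X']
  set MX := Subfield.extendScalars hAX
  set MX' := Subfield.extendScalars hA'X'
  haveI : Module.Finite A MX := Module.finite_of_finrank_pos hfin
  let b := Module.finBasis A MX
  -- the basis vectors, viewed in `X'`
  let v : Fin (Module.finrank A MX) → MX' := fun i => ⟨(b i : R), hXX' (b i).2⟩
  -- every `g ∈ G` is an `A'`-combination of the `b i`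
  have hG : G ⊆ Submodule.span A' (Set.range fun i => (b i : R)) := by
    intro g hg
    set m : MX := ⟨g, hGX hg⟩ with hm
    have hg' : (m : R) = ∑ i, ((b.repr m i : A) : R) * (b i : R) := by
      conv_lhs => rw [← b.sum_repr m]
      rw [AddSubmonoidClass.coe_finsetSum]
      exact Finset.sum_congr rfl fun i _ => rfl
    have hsum : ∑ i, ((b.repr m i : A) : R) * (b i : R) ∈
        Submodule.span A' (Set.range fun i => (b i : R)) := by
      refine Submodule.sum_mem _ fun i _ => ?_
      have hsmul : ((b.repr m i : A) : R) * (b i : R) =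
          (⟨((b.repr m i : A) : R), hAA' (b.repr m i).2⟩ : A') • (b i : R) := rfl
      rw [hsmul]
      exact Submodule.smul_mem _ _ (Submodule.subset_span ⟨i, rfl⟩)
    rw [← hg'] at hsum
    exact hsum
  -- hence the `v i` span `X'` over `A'`
  have hspan' : Submodule.span A' (Set.range v) = ⊤ := by
    refine eq_top_iff.mpr fun z _ => ?_
    have hinj : Function.Injective ((IntermediateField.val MX').toLinearMap) :=
      (IntermediateField.val MX').toRingHom.injective
    rw [← Submodule.apply_mem_span_image_iff_mem_span hinj, ← Set.range_comp]
    have hcomp : ((IntermediateField.val MX').toLinearMap ∘ v) = fun i => (b i : R) := rfl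
    rw [hcomp]
    exact Submodule.span_le.mpr hG (hspan z z.2)
  calc Module.finrank A' MX' = Module.finrank A' (⊤ : Submodule A' MX') := by rw [finrank_top]
    _ = Set.finrank A' (Set.range v) := by rw [← hspan']; rfl
    _ ≤ Fintype.card (Fin (Module.finrank A MX)) := finrank_range_le_card v
    _ = Module.finrank A MX := Fintype.card_fin _

end Literature.AlgebraicGeometry.Resolution

end
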